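import Summits.ResolutionOfSingularities.ResolutionOfSingularities.Theorems.WeightedInvariantContactCylinderStratumMap
import Summits.ResolutionOfSingularities.ResolutionOfSingularities.Theorems.WeightedInvariantIota3EpsStratumMap
import Summits.ResolutionOfSingularities.ResolutionOfSingularities.Theorems.WeightedInvariantIota3Tau
import HarnessLib

/-!
# (c11)≤3 for the flat centre filtration `J₃ᵗ = Iota3.jFlatT`, PART 1 — top-stratum base change for a POINTWISE-COMPATIBLE
# stratifier, and the pointwise compatibility of `(ν ; ε)` / of `(ν ; ε ; τ)` given `τ`
# (door `HypersurfaceCentreConstruction`, stmt-ResolutionOfSingularities-19897; P3 rung clause (c11)≤3, J-half of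
# `IotaJEssSmoothCompatibleLE 3 p Iota3.iotaFlatT Iota3.jFlatT`; ORDER (o53) of res-L1-w43-plan-1, hand res-L1-w43-stub-3)

Topic: `Summits/ResolutionOfSingularities/ResolutionOfSingularities/Theorems`. Helper for the door item
`HypersurfaceCentreConstruction` (stmt-ResolutionOfSingularities-19897, route `WeightedInvariant`), line `local-engine`
(L W4.3), def-free.  MEMO `L/res-L1-w43-stub-3/g5/O53-MEMO.md` §1 (T1).  `jFlatT = jCylinder ι₀ jFlatCoreE` reads its core at
the generic prime of the top `ι₀`-stratum, `ι₀ = (ν ; ε ; τ)`; the first step of its (c11) is the behaviour of that stratum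
under an essentially smooth local homomorphism `φ : S → S'` of regular local rings:

* §1 `mem_topStratum_map_iff_of_pointwise`, `topStratum_map_of_pointwise[_of_eq]`, `topStratumPrime_map_of_pointwise` — for
  ANY stratifier `ι` compatible with `φ` at the closed point and at every prime `𝔮'` of `S'`
  (`ι (S'_{𝔮'}) (φ f) = ι (S_{𝔮' ∩ S}) f`): `topStratum ι S' (φ f) = (Spec φ)⁻¹ (topStratum ι S f)`, `V(P) ↦ V(P S')`
  (005/brk-1's `topStratum_iotaOrd_map`, p526917, with the letter abstracted; no regularity needed).
* §2 the pointwise compatibility HOLDS for `(ν ; ε)` — res-type-013's `Iota3.iotaOrdEps_atPrime_eq_iotaOrdEps_atPrime_comap`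
  (`…Iota3EpsStratumMap`, imported: `iotaOrdEps_essSmooth_eq` p528660 along the LOCALISED homomorphism `S_{𝔮'∩S} → S'_{𝔮'}`,
  again local, formally smooth, essentially of finite type between regular local rings); `iotaOrdEpsTau_atPrime_eq_of_iotaTau`,
  `iotaOrdEpsTau_map_eq_of_iotaTau`, **`topStratum_iotaOrdEpsTau_map_of_eq`** — the same for `ι₀ = (ν ; ε ; τ)` and the
  base change `V(P) ↦ V(P S')` of its top stratum, GIVEN the pointwise compatibility of `τ` (= res-type-013's (c11τ)≤3, OPEN:
  the hypotheses `hτ` / `hτpt`, stated, not assumed away).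

[OURS · L1 W4.3 · (o53)]  Replaces the role of NO printed item; NOT a statement of the manuscript
[claim: Hironaka2017, status: under-review]. AI work, weaker than expert review.  Pure commutative algebra; no named facts.

## References

* H. Matsumura, *Commutative Ring Theory* (1987), Thm. 19.3, §22 Cor. to Thm. 22.5. [Matsumura1987]
-/

noncomputable section

open IsLocalRing Literature.AlgebraicGeometry.Resolution
open Summit.ResolutionOfSingularities.ResolutionOfSingularities.Cruxes.HypersurfaceCentreConstruction.LocalEngine
open Summit.ResolutionOfSingularities.ResolutionOfSingularities.Cruxes.HypersurfaceCentreConstruction.LocalEngine.Iota3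

set_option linter.dupNamespace false -- mandated namespace of this single-conjunct summit

namespace Summit.ResolutionOfSingularities.ResolutionOfSingularities.Theorems

namespace JFlatEssSmooth

open ContactCylinder

/-! ## §1 Top-stratum base change for a pointwise-compatible stratifier -/

section Stratum

variable {ι : (R : Type) → [CommRing R] → R → Ordinal.{0}}
variable (S S' : Type) [CommRing S] [CommRing S'] [Algebra S S']

/-- A prime `𝔮'` of `S'` lies on the top `ι`-stratum of `φ f` iff its contraction lies on the top `ι`-stratum of `f`, as soon as
`ι` is compatible with `φ` at the closed point and at `𝔮'`. [folklore] -/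
theorem mem_topStratum_map_iff_of_pointwise (f : S) (hι : ι S' (algebraMap S S' f) = ι S f) (𝔮' : PrimeSpectrum S')
    (h𝔮' : ι (Localization.AtPrime 𝔮'.asIdeal) (algebraMap S (Localization.AtPrime 𝔮'.asIdeal) f) =
      ι (Localization.AtPrime (𝔮'.asIdeal.comap (algebraMap S S')))
        (algebraMap S (Localization.AtPrime (𝔮'.asIdeal.comap (algebraMap S S'))) f)) :
    𝔮' ∈ topStratum ι S' (algebraMap S S' f) ↔ PrimeSpectrum.comap (algebraMap S S') 𝔮' ∈ topStratum ι S f := by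
  rw [ContactCylinder.mem_topStratum_iff, ContactCylinder.mem_topStratum_iff, hι,
    ← IsScalarTower.algebraMap_apply S S' (Localization.AtPrime 𝔮'.asIdeal) f,
    h𝔮']
  exact Iff.rfl

/-- **Top-stratum base change**: `topStratum ι S' (φ f) = (Spec φ)⁻¹ (topStratum ι S f)` for a stratifier compatible with `φ`
at the closed point and at every prime of `S'`. [folklore] -/
theorem topStratum_map_of_pointwise (f : S) (hι : ι S' (algebraMap S S' f) = ι S f)
    (hpt : ∀ (𝔮' : Ideal S') [𝔮'.IsPrime], ι (Localization.AtPrime 𝔮') (algebraMap S (Localization.AtPrime 𝔮') f) =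
      ι (Localization.AtPrime (𝔮'.comap (algebraMap S S'))) (algebraMap S (Localization.AtPrime (𝔮'.comap (algebraMap S S'))) f)) :
    topStratum ι S' (algebraMap S S' f) = PrimeSpectrum.comap (algebraMap S S') ⁻¹' topStratum ι S f := by
  ext 𝔮'
  exact mem_topStratum_map_iff_of_pointwise S S' f hι 𝔮' (hpt 𝔮'.asIdeal)

/-- If the top `ι`-stratum of `S` is `V(P)`, that of `S'` is `V(P S')`. [folklore] -/
theorem topStratum_map_of_pointwise_of_eq (f : S) (hι : ι S' (algebraMap S S' f) = ι S f)
    (hpt : ∀ (𝔮' : Ideal S') [𝔮'.IsPrime], ι (Localization.AtPrime 𝔮') (algebraMap S (Localization.AtPrime 𝔮') f) =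
      ι (Localization.AtPrime (𝔮'.comap (algebraMap S S'))) (algebraMap S (Localization.AtPrime (𝔮'.comap (algebraMap S S'))) f))
    {P : Ideal S} (hE : topStratum ι S f = {𝔮 | P ≤ 𝔮.asIdeal}) :
    topStratum ι S' (algebraMap S S' f) = {𝔮' | P.map (algebraMap S S') ≤ 𝔮'.asIdeal} := by
  ext 𝔮'
  rw [mem_topStratum_map_iff_of_pointwise S S' f hι 𝔮' (hpt 𝔮'.asIdeal), hE, Set.mem_setOf_eq, Set.mem_setOf_eq,
    Ideal.map_le_iff_le_comap]
  exact Iff.rfl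

/-- … hence the generic prime of the top `ι`-stratum of `S'` is `P S'` whenever that is prime. [folklore] -/
theorem topStratumPrime_map_of_pointwise (f : S) (hι : ι S' (algebraMap S S' f) = ι S f)
    (hpt : ∀ (𝔮' : Ideal S') [𝔮'.IsPrime], ι (Localization.AtPrime 𝔮') (algebraMap S (Localization.AtPrime 𝔮') f) =
      ι (Localization.AtPrime (𝔮'.comap (algebraMap S S'))) (algebraMap S (Localization.AtPrime (𝔮'.comap (algebraMap S S'))) f))
    {P : Ideal S} (hE : topStratum ι S f = {𝔮 | P ≤ 𝔮.asIdeal}) [(P.map (algebraMap S S')).IsPrime] :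
    topStratumPrime ι S' (algebraMap S S' f) = P.map (algebraMap S S') :=
  topStratumPrime_eq_of_topStratum_eq ι S' _ (topStratum_map_of_pointwise_of_eq S S' f hι hpt hE)

end Stratum

/-! ## §2 Pointwise compatibility of `(ν ; ε)` and of `(ν ; ε ; τ)` given `τ` -/

section Pointwise

variable (S S' : Type) [CommRing S] [IsRegularLocalRing S] [CommRing S'] [IsRegularLocalRing S'] [Algebra S S']
  [Algebra.FormallySmooth S S'] [Algebra.EssFiniteType S S']

/-- **`(ν ; ε ; τ)` at a prime of `S'` equals `(ν ; ε ; τ)` at its contraction, GIVEN the same for `τ`** (the τ-half is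
res-type-013's (c11τ)≤3, open: it enters as the hypothesis `hτ`). [OURS · (o53)] -/
theorem iotaOrdEpsTau_atPrime_eq_of_iotaTau (f : S) (𝔮' : Ideal S') [𝔮'.IsPrime]
    (hτ : iotaTau (Localization.AtPrime 𝔮') (algebraMap S (Localization.AtPrime 𝔮') f) =
      iotaTau (Localization.AtPrime (𝔮'.comap (algebraMap S S')))
        (algebraMap S (Localization.AtPrime (𝔮'.comap (algebraMap S S'))) f)) :
    iotaOrdEpsTau (Localization.AtPrime 𝔮') (algebraMap S (Localization.AtPrime 𝔮') f) =
      iotaOrdEpsTau (Localization.AtPrime (𝔮'.comap (algebraMap S S')))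
        (algebraMap S (Localization.AtPrime (𝔮'.comap (algebraMap S S'))) f) := by
  rw [iotaOrdEpsTau_eq_iff]
  exact ⟨Iota3.iotaOrdEps_atPrime_eq_iotaOrdEps_atPrime_comap S S' f 𝔮', hτ⟩

variable [IsLocalHom (algebraMap S S')]

/-- **`(ν ; ε ; τ)` at the closed points agree, GIVEN the same for `τ`.** [OURS · (o53)] -/
theorem iotaOrdEpsTau_map_eq_of_iotaTau (f : S) (hτ : iotaTau S' (algebraMap S S' f) = iotaTau S f) :
    iotaOrdEpsTau S' (algebraMap S S' f) = iotaOrdEpsTau S f := by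
  rw [iotaOrdEpsTau_eq_iff]
  exact ⟨iotaOrdEps_essSmooth_eq S S' f, hτ⟩

/-- **The top `ι₀`-stratum, `ι₀ = (ν ; ε ; τ)`, under essentially smooth base change, GIVEN the τ-compatibilities**:
`V(P) ↦ V(P S')`. [OURS · (o53)] -/
theorem topStratum_iotaOrdEpsTau_map_of_eq (f : S) (hτ : iotaTau S' (algebraMap S S' f) = iotaTau S f)
    (hτpt : ∀ (𝔮' : Ideal S') [𝔮'.IsPrime], iotaTau (Localization.AtPrime 𝔮') (algebraMap S (Localization.AtPrime 𝔮') f) =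
      iotaTau (Localization.AtPrime (𝔮'.comap (algebraMap S S')))
        (algebraMap S (Localization.AtPrime (𝔮'.comap (algebraMap S S'))) f))
    {P : Ideal S} (hE : topStratum iotaOrdEpsTau S f = {𝔮 | P ≤ 𝔮.asIdeal}) :
    topStratum iotaOrdEpsTau S' (algebraMap S S' f) = {𝔮' | P.map (algebraMap S S') ≤ 𝔮'.asIdeal} :=
  topStratum_map_of_pointwise_of_eq S S' f (iotaOrdEpsTau_map_eq_of_iotaTau S S' f hτ)
    (fun 𝔮' _ => iotaOrdEpsTau_atPrime_eq_of_iotaTau S S' f 𝔮' (hτpt 𝔮')) hE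

end Pointwise

end JFlatEssSmooth

end Summit.ResolutionOfSingularities.ResolutionOfSingularities.Theorems

end
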